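import Mathlib.GroupTheory.Perm.Cycle.Factors
import Mathlib.GroupTheory.Perm.List

/-!
# Route «KPlusLogSqLaw» — structure lemma: the PORT-RELEASE DICHOTOMY (Δ-lemma) for pairs of almost-admissible permutations

HONEST FRAMING.  Helper file (`--supports stmt-ValiantsHypothesis-19561`), pure permutation combinatorics, no design vocabulary.  It is the
kernel form of law (P4)/«Δ-lemma» of the cell's K = 4 digest (HOME/val-sym-lift-p1/g6/K4-DESIGN-OBSTRUCTIONS.md §3, HOME/val-sym-lift-p1/g7/
K4-JOINT-OBSTRUCTION-DIGEST.md §0 L9), the mechanism that kills every «port-release zone» architecture for cubic `(m,4)` tropical families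
(digest table #16): in a bipartite support, if the row–column pairs `(r_x, c_x)` and `(r_y, c_y)` can each be RELEASED (a perfect matching of the
rest exists), then EITHER both CROSS releases `(r_x, c_y)`, `(r_y, c_x)` exist OR both the CLOSED matching (nothing released) and the DOUBLE
release exist.  In permutation language (rows `→` columns as `Equiv.Perm`, «released pair» = the one position where adjacency is not required):
`portRelease`.  The proof is the alternating-path argument written with `Equiv.Perm.cycleOf` (the two released rows lie in different cycles of
`σ⁻¹τ`: swap one cycle) and `List.formPerm` (same cycle: re-close the arc from `r_x` to `r_y`).  STRUCTURAL LEMMA ONLY: nothing is asserted about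
`TropicalB`, `WeakLifting`, `Lifting`, `MatrixDescartes` (stmt-ValiantsHypothesis-18050) or VP ≠ VNP.  Seat val-sym-lift-p1 g7, cell `pub-symmetroid`,
2026-08-27. [folklore] (symmetric difference of two matchings = alternating paths).
-/

set_option linter.dupNamespace false
set_option autoImplicit false

namespace Summit.ValiantsHypothesis.ValiantsHypothesis.Theorems.KPlusLogSqLaw

namespace PortRelease

open Equiv Equiv.Perm

variable {α : Type*} [DecidableEq α] [Fintype α]

/-- **Cycle swap.**  For permutations `σ, τ` and a point `x`, the permutation `σ * (σ⁻¹ * τ).cycleOf x` agrees with `τ` on the `σ⁻¹τ`-cycle of `x`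
and with `σ` off it. [folklore] -/
theorem cycleSwap_apply (σ τ : Perm α) (x r : α) :
    (σ * (σ⁻¹ * τ).cycleOf x) r = if (σ⁻¹ * τ).SameCycle x r then τ r else σ r := by
  rw [Perm.mul_apply, cycleOf_apply]
  split_ifs with h
  · rw [Perm.mul_apply, Perm.inv_def, Equiv.apply_symm_apply]
  · rfl

omit [DecidableEq α] [Fintype α] in
/-- the powers `(π^i) x`, `i ≤ j+1`, are pairwise distinct when `j` is minimal with `(π^(j+1)) x = y ≠ x`. [folklore] -/
theorem pow_apply_injOn (π : Perm α) {x y : α} (hne : x ≠ y) {j : ℕ} (hj : (π ^ (j + 1)) x = y)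
    (hmin : ∀ i < j, (π ^ (i + 1)) x ≠ y) {a b : ℕ} (hab : a < b) (hb : b ≤ j + 1) :
    (π ^ a) x ≠ (π ^ b) x := by
  intro h
  -- x = (π^(b-a)) x
  have hx : (π ^ (b - a)) x = x := by
    have h1 : (π ^ a) ((π ^ (b - a)) x) = (π ^ a) x := by
      rw [← Perm.mul_apply, ← pow_add, show a + (b - a) = b by omega, ← h]
    exact (π ^ a).injective h1
  -- then (π^(j+1-(b-a))) x = y
  have hy : (π ^ (j + 1 - (b - a))) x = y := by
    have : (π ^ (j + 1 - (b - a))) ((π ^ (b - a)) x) = y := by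
      rw [← Perm.mul_apply, ← pow_add, show j + 1 - (b - a) + (b - a) = j + 1 by omega, hj]
    rwa [hx] at this
  rcases Nat.eq_zero_or_pos (j + 1 - (b - a)) with h0 | hpos
  · rw [h0, pow_zero, Perm.one_apply] at hy
    exact hne hy
  · have := hmin (j + 1 - (b - a) - 1) (by omega)
    rw [show j + 1 - (b - a) - 1 + 1 = j + 1 - (b - a) by omega] at this
    exact this hy

/-- **Arc re-closing.**  If `x ≠ y` lie in the same cycle of `π = σ⁻¹τ`, there is a permutation `ρ` with `ρ y = σ x` which elsewhere agrees
with `τ` (on the arc from `x` to `y`) or with `σ` (off the arc, never at `x`). [folklore] -/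
theorem exists_reclose (σ τ : Perm α) {x y : α} (hne : x ≠ y) (h : (σ⁻¹ * τ).SameCycle x y) :
    ∃ ρ : Perm α, ρ y = σ x ∧ ∀ r, r ≠ y → ρ r = τ r ∨ (ρ r = σ r ∧ r ≠ x) := by
  classical
  set π : Perm α := σ⁻¹ * τ with hπ
  have hex : ∃ i : ℕ, (π ^ (i + 1)) x = y := by
    obtain ⟨i, hi0, -, hi⟩ := h.exists_pow_eq''
    exact ⟨i - 1, by rwa [Nat.sub_add_cancel hi0]⟩
  let j := Nat.find hex
  have hj : (π ^ (j + 1)) x = y := Nat.find_spec hex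
  have hmin : ∀ i < j, (π ^ (i + 1)) x ≠ y := fun i hi => Nat.find_min hex hi
  -- the arc as a list: l[i] = (π^i) x for i ≤ j+1 (so l[j+1] = y)
  let l : List α := (List.range (j + 2)).map fun i => (π ^ i) x
  have hlen : l.length = j + 2 := by simp [l]
  have hget : ∀ (i : ℕ) (hi : i < l.length), l[i] = (π ^ i) x := by
    intro i hi
    simp [l, List.getElem_map, List.getElem_range]
  have hnodup : l.Nodup := by
    refine (List.nodup_range).map_on ?_
    intro a ha b hb hab
    rw [List.mem_range] at ha hb
    by_contra hne'
    rcases lt_or_gt_of_ne hne' with hlt | hlt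
    · exact pow_apply_injOn π hne hj hmin hlt (by omega) hab
    · exact pow_apply_injOn π hne hj hmin hlt (by omega) hab.symm
  have hmem : ∀ r, r ∈ l ↔ ∃ i, i ≤ j + 1 ∧ (π ^ i) x = r := by
    intro r
    simp only [l, List.mem_map, List.mem_range]
    constructor
    · rintro ⟨i, hi, rfl⟩; exact ⟨i, by omega, rfl⟩
    · rintro ⟨i, hi, rfl⟩; exact ⟨i, by omega, rfl⟩
  have key : ∀ z, σ (π z) = τ z := fun z => by
    rw [hπ, Perm.mul_apply, Perm.inv_def, Equiv.apply_symm_apply]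
  refine ⟨σ * l.formPerm, ?_, ?_⟩
  · -- ρ y = σ (formPerm y) = σ l[0] = σ x
    have h1 := List.formPerm_apply_getElem l hnodup (j + 1) (by rw [hlen]; omega)
    rw [hget, hget] at h1
    have h2 : (j + 1 + 1) % l.length = 0 := by rw [hlen]; exact Nat.mod_self _
    rw [h2, pow_zero, Perm.one_apply, hj] at h1
    rw [Perm.mul_apply, h1]
  · intro r hr
    by_cases hrl : r ∈ l
    · -- r = (π^i) x with i ≤ j (i = j+1 is y): formPerm r = (π^(i+1)) x = π r, so ρ r = τ r
      obtain ⟨i, hi, rfl⟩ := (hmem r).mp hrl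
      have hij : i ≤ j := by
        by_contra hc
        have : i = j + 1 := by omega
        rw [this, hj] at hr
        exact hr rfl
      left
      have h1 := List.formPerm_apply_getElem l hnodup i (by rw [hlen]; omega)
      rw [hget, hget] at h1
      have h2 : (i + 1) % l.length = i + 1 := by rw [hlen]; exact Nat.mod_eq_of_lt (by omega)
      rw [h2] at h1
      rw [Perm.mul_apply, h1, pow_succ', Perm.mul_apply, key]
    · right
      rw [Perm.mul_apply, List.formPerm_apply_of_notMem hrl]
      refine ⟨rfl, ?_⟩
      rintro rfl
      exact hrl ((hmem r).mpr ⟨0, by omega, by simp⟩)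

/-- **PORT-RELEASE DICHOTOMY (Δ-lemma).**  Let `adj` be a row–column adjacency, `σ` a permutation admissible except possibly at the row `x`
(the pair `(x, σ x)` is «released») and `τ` admissible except possibly at the row `y ≠ x`.  Then EITHER there are permutations realising both
CROSS releases — `ρ₁ y = σ x` admissible off `y`, and `ρ₂ x = τ y` admissible off `x` — OR there are a fully admissible `ρ₃` (CLOSED) and a `ρ₄`
with `ρ₄ x = σ x`, `ρ₄ y = τ y` admissible off `{x, y}` (DOUBLE release). [folklore] -/
theorem portRelease (adj : α → α → Prop) (σ τ : Perm α) {x y : α} (hne : x ≠ y)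
    (hσ : ∀ r, r ≠ x → adj r (σ r)) (hτ : ∀ r, r ≠ y → adj r (τ r)) :
    ((∃ ρ₁ : Perm α, ρ₁ y = σ x ∧ ∀ r, r ≠ y → adj r (ρ₁ r)) ∧
      (∃ ρ₂ : Perm α, ρ₂ x = τ y ∧ ∀ r, r ≠ x → adj r (ρ₂ r))) ∨
    ((∃ ρ₃ : Perm α, ∀ r, adj r (ρ₃ r)) ∧
      (∃ ρ₄ : Perm α, ρ₄ x = σ x ∧ ρ₄ y = τ y ∧ ∀ r, r ≠ x → r ≠ y → adj r (ρ₄ r))) := by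
  classical
  by_cases h : (σ⁻¹ * τ).SameCycle x y
  · left
    constructor
    · obtain ⟨ρ, hρy, hρ⟩ := exists_reclose σ τ hne h
      refine ⟨ρ, hρy, fun r hr => ?_⟩
      rcases hρ r hr with h1 | ⟨h1, h2⟩
      · rw [h1]; exact hτ r hr
      · rw [h1]; exact hσ r h2
    · have h' : (τ⁻¹ * σ).SameCycle y x := by
        have : τ⁻¹ * σ = (σ⁻¹ * τ)⁻¹ := by rw [mul_inv_rev, inv_inv]
        rw [this, sameCycle_inv]
        exact h.symm
      obtain ⟨ρ, hρx, hρ⟩ := exists_reclose τ σ hne.symm h'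
      refine ⟨ρ, hρx, fun r hr => ?_⟩
      rcases hρ r hr with h1 | ⟨h1, h2⟩
      · rw [h1]; exact hσ r hr
      · rw [h1]; exact hτ r h2
  · right
    constructor
    · refine ⟨σ * (σ⁻¹ * τ).cycleOf x, fun r => ?_⟩
      rw [cycleSwap_apply]
      split_ifs with hr
      · exact hτ r (fun hry => h (hry ▸ hr))
      · exact hσ r (fun hrx => hr (hrx ▸ Perm.SameCycle.refl _ _))
    · refine ⟨σ * (σ⁻¹ * τ).cycleOf y, ?_, ?_, fun r hrx hry => ?_⟩
      · rw [cycleSwap_apply, if_neg (fun hyx => h hyx.symm)]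
      · rw [cycleSwap_apply, if_pos (Perm.SameCycle.refl _ _)]
      · rw [cycleSwap_apply]
        split_ifs with hr
        · exact hτ r hry
        · exact hσ r hrx

end PortRelease

end Summit.ValiantsHypothesis.ValiantsHypothesis.Theorems.KPlusLogSqLaw
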